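import Literature.Algebra.EuclideanLattices.ConvexBodyLatticePoints
import Literature.Algebra.EuclideanLattices.BallIntersectionVolume
import HarnessLib

/-!
# Grid points in the intersection of two balls (Regev 2004, Corollary 3.9)

Topic `Literature/Algebra/EuclideanLattices` (geometry of numbers). Everything in this file is
PROVED (theorems only, no named fact); it is groundwork for the named fact
`Literature.Algebra.EuclideanLattices.usvp_of_dihedralCoset` (Regev 2004, Thm. 1.1): the estimate
that controls the failure probability of one two-point register in Regev's ball algorithm
(Lemma 3.12, Claim 3.14: a uniformly random grid point of `B̄(0,R)` lies in `B̄(d,R)` with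
probability `≥ 1 − O(√n ‖d‖/R)`).

**Corollary 3.9** (Regev: `L = 2ⁿ`, `R ≥ 1`, `R/poly(n) ≤ ‖d‖ ≤ R`; here with explicit constants, for
every `L > 0`, `R > 0`, `d ∈ ℝⁿ`, `n ≥ 2`, the exponentially small grid error kept as a separate term
instead of being absorbed into the `O(·)`):

  `#((1/L)ℤⁿ ∩ B̄(0,R) ∩ B̄(d,R)) ≥ (1 − √n ‖d‖/R − 3 n^{1.5}/(R L)) · #((1/L)ℤⁿ ∩ B̄(0,R))`

(`sub_mul_card_scaledGrid_le_card_inter`), from Claim 3.7 (`BallIntersectionVolume.lean`) and the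
two halves of Claim 3.8 (`ConvexBodyLatticePoints.lean`: the count of `B̄(0,R) ∩ B̄(d,R) ⊇
B̄(d/2, R/2)` from below, the count of `B̄(0,R)` from above), first for an arbitrary basis of `ℝⁿ`
with cell radius `ρ` (`sub_mul_card_le_card_inter`, error term `3nρ/R`), and in particular for the
integer lattice `ℤⁿ` (`L = 1`, `sub_mul_card_intGrid_le_card_inter`), which is the form used after
scaling Regev's grid by `L`.  We also record the elementary bridge between `ℤⁿ ⊆ ℝⁿ` and integer
vectors `Fin n → ℤ` (`intVec`, `intVec_mem_scaledGrid_one`, `exists_intVec_eq`, `norm_intVec_sq`).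

## References

* O. Regev, *Quantum computation and lattice problems*, SIAM J. Comput. 33 (2004) 738–760, §3.3,
  Cor. 3.9 and its proof (p. 11 of the journal version), Claim 3.14 (p. 15) [Regev2004].
-/

noncomputable section

open MeasureTheory Module Submodule Bornology Set Metric ZSpan WithLp
open scoped ENNReal

namespace Literature.Algebra.EuclideanLattices

/-! ## Two elementary inequalities -/

/-- `1 − a − b − c ≤ (1 − a)(1 − b)(1 − c)` for `a ∈ [0, 1]`, `b, c ≥ 0`. [folklore] -/
theorem one_sub_sub_sub_le_mul_mul {a b c : ℝ} (ha : 0 ≤ a) (hb : 0 ≤ b) (hc : 0 ≤ c)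
    (ha1 : a ≤ 1) :
    1 - a - b - c ≤ (1 - a) * (1 - b) * (1 - c) := by
  nlinarith [mul_nonneg ha hb, mul_nonneg (mul_nonneg ha hb) hc, mul_nonneg ha hc, mul_nonneg hb hc]

/-- `(1 + s)ⁿ (1 − n s) ≤ 1` for `0 ≤ s` (from `(1 + s)(1 − s) ≤ 1` and Bernoulli). [folklore] -/
theorem one_add_pow_mul_one_sub_le {s : ℝ} (hs : 0 ≤ s) (n : ℕ) :
    (1 + s) ^ n * (1 - n * s) ≤ 1 := by
  rcases le_or_gt 1 (n * s) with h | h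
  · have h2 : 0 ≤ (1 + s) ^ n := by positivity
    nlinarith [mul_nonneg h2 (by linarith : (0 : ℝ) ≤ n * s - 1)]
  · rcases Nat.eq_zero_or_pos n with hn | hn
    · subst hn; simp
    · have hn1 : (1 : ℝ) ≤ n := by exact_mod_cast hn
      have hs1 : s < 1 := by nlinarith
      have hB : 1 - n * s ≤ (1 - s) ^ n := by
        have h' := one_add_mul_le_pow (a := -s) (by linarith) n
        have e1 : (1 : ℝ) + -s = 1 - s := by ring
        have e2 : (1 : ℝ) + n * -s = 1 - n * s := by ring
        rwa [e1, e2] at h'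
      have hprod : (1 + s) ^ n * (1 - s) ^ n ≤ 1 := by
        rw [← mul_pow]
        exact pow_le_one₀ (by nlinarith) (by nlinarith)
      calc (1 + s) ^ n * (1 - n * s) ≤ (1 + s) ^ n * (1 - s) ^ n := by gcongr
        _ ≤ 1 := hprod

/-! ## Corollary 3.9 for an arbitrary basis of `ℝⁿ` -/

section General

variable {n : ℕ} {ι : Type*} [Fintype ι] (b : Basis ι ℝ (EuclideanSpace ℝ (Fin n)))

/-- The ball `B̄(d/2, R/2)` lies in `B̄(0,R) ∩ B̄(d,R)` when `‖d‖ ≤ R`. [cite: Regev2004, Cor. 3.9 (proof)] -/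
theorem closedBall_half_subset_inter {E : Type*} [NormedAddCommGroup E] [NormedSpace ℝ E]
    {d : E} {R : ℝ} (hd : ‖d‖ ≤ R) :
    closedBall ((1 / 2 : ℝ) • d) (R / 2) ⊆ closedBall 0 R ∩ closedBall d R := by
  intro y hy
  rw [mem_closedBall, dist_eq_norm] at hy
  have hhalf : ‖(1 / 2 : ℝ) • d‖ = ‖d‖ / 2 := by
    rw [norm_smul, Real.norm_of_nonneg (by norm_num)]; ring
  constructor
  · rw [mem_closedBall, dist_zero_right]
    calc ‖y‖ = ‖(y - (1 / 2 : ℝ) • d) + (1 / 2 : ℝ) • d‖ := by rw [sub_add_cancel]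
      _ ≤ ‖y - (1 / 2 : ℝ) • d‖ + ‖(1 / 2 : ℝ) • d‖ := norm_add_le _ _
      _ ≤ R / 2 + ‖d‖ / 2 := by rw [hhalf]; gcongr
      _ ≤ R := by linarith
  · rw [mem_closedBall, dist_eq_norm]
    have e : y - d = (y - (1 / 2 : ℝ) • d) - (1 / 2 : ℝ) • d := by
      rw [sub_sub, ← add_smul]; norm_num
    calc ‖y - d‖ = ‖(y - (1 / 2 : ℝ) • d) - (1 / 2 : ℝ) • d‖ := by rw [e]
      _ ≤ ‖y - (1 / 2 : ℝ) • d‖ + ‖(1 / 2 : ℝ) • d‖ := norm_sub_le _ _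
      _ ≤ R / 2 + ‖d‖ / 2 := by rw [hhalf]; gcongr
      _ ≤ R := by linarith

/-- **Regev 2004, Cor. 3.9, for an arbitrary basis of `ℝⁿ` with cell radius `ρ`.**  For `n ≥ 2`,
`R > 0`, `ρ ≥ 0` with `‖x − ⌊x⌋_b‖ ≤ ρ` for all `x`, and any `d ∈ ℝⁿ`, the lattice `Λ = span_ℤ b`
satisfies `(1 − √n ‖d‖/R − 3nρ/R) · #(Λ ∩ B̄(0,R)) ≤ #(Λ ∩ B̄(0,R) ∩ B̄(d,R))`.
(No further hypothesis: when the factor is `≤ 0` the bound is empty, and when it is positive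
`‖d‖ < R` and `3nρ < R`, which is all the proof needs.) [cite: Regev2004, Cor. 3.9] -/
theorem sub_mul_card_le_card_inter (hn : 2 ≤ n) {ρ : ℝ} (hρ0 : 0 ≤ ρ)
    (hρ : ∀ x : EuclideanSpace ℝ (Fin n), ‖x - (floor b x : EuclideanSpace ℝ (Fin n))‖ ≤ ρ)
    {R : ℝ} (hR : 0 < R) (d : EuclideanSpace ℝ (Fin n)) :
    (1 - Real.sqrt n * ‖d‖ / R - 3 * n * ρ / R) *
        Nat.card (closedBall (0 : EuclideanSpace ℝ (Fin n)) R ∩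
          (span ℤ (Set.range b) : Set (EuclideanSpace ℝ (Fin n))) : Set (EuclideanSpace ℝ (Fin n))) ≤
      Nat.card ((closedBall (0 : EuclideanSpace ℝ (Fin n)) R ∩ closedBall d R) ∩
          (span ℤ (Set.range b) : Set (EuclideanSpace ℝ (Fin n))) : Set (EuclideanSpace ℝ (Fin n))) := by
  set Λ : Set (EuclideanSpace ℝ (Fin n)) := (span ℤ (Set.range b) : Set (EuclideanSpace ℝ (Fin n)))
    with hΛ
  set B : Set (EuclideanSpace ℝ (Fin n)) := closedBall 0 R with hB
  set S : Set (EuclideanSpace ℝ (Fin n)) := closedBall 0 R ∩ closedBall d R with hS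
  set NB : ℝ := (Nat.card (B ∩ Λ : Set (EuclideanSpace ℝ (Fin n))) : ℝ) with hNB
  set NS : ℝ := (Nat.card (S ∩ Λ : Set (EuclideanSpace ℝ (Fin n))) : ℝ) with hNS
  set a : ℝ := Real.sqrt n * ‖d‖ / R with ha
  set s : ℝ := ρ / R with hs
  have hNS0 : 0 ≤ NS := Nat.cast_nonneg _
  have hNB0 : 0 ≤ NB := Nat.cast_nonneg _
  have hgoal : 3 * (n : ℝ) * ρ / R = 3 * (n * s) := by rw [hs]; ring
  rw [hgoal]
  -- trivial case
  rcases le_or_gt (1 - a - 3 * (n * s)) 0 with htriv | hpos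
  · exact (mul_nonpos_of_nonpos_of_nonneg htriv hNB0).trans hNS0
  -- now `a < 1` and `3 n s < 1`
  have hn1 : (1 : ℝ) ≤ n := by exact_mod_cast (by omega : 1 ≤ n)
  have hsqrt1 : 1 ≤ Real.sqrt n := by
    rw [show (1 : ℝ) = Real.sqrt 1 from Real.sqrt_one.symm]
    exact Real.sqrt_le_sqrt hn1
  have ha0 : 0 ≤ a := by positivity
  have hs0 : 0 ≤ s := by positivity
  have ha1 : a < 1 := by nlinarith
  have hns : 3 * (n * s) < 1 := by linarith
  have hdR : ‖d‖ ≤ R := by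
    have h1 : Real.sqrt n * ‖d‖ < R := by
      rw [ha, div_lt_one hR] at ha1; exact ha1
    nlinarith [norm_nonneg d]
  have hρR2 : ρ ≤ R / 2 := by
    have h1 : 3 * (n * (ρ / R)) < 1 := hns
    rw [show 3 * (n * (ρ / R)) = (3 * n * ρ) / R by ring, div_lt_one hR] at h1
    nlinarith
  -- the three ingredients
  have hconvS : Convex ℝ S := (convex_closedBall _ _).inter (convex_closedBall _ _)
  have hbddS : IsBounded S := isBounded_closedBall.subset inter_subset_left
  have hballS : closedBall ((1 / 2 : ℝ) • d) (R / 2) ⊆ S := closedBall_half_subset_inter hdR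
  have hlow := pow_mul_measureReal_le_card_mul b volume hρ0 hρ hconvS hbddS (by positivity) hρR2
    hballS
  have hup := card_mul_le_pow_mul_measureReal b volume hρ0 hρ (convex_closedBall _ _)
    isBounded_closedBall hR (subset_refl (closedBall (0 : EuclideanSpace ℝ (Fin n)) R))
  have h37 := sub_mul_volume_closedBall_le_volume_inter hn hR d
  rw [finrank_euclideanSpace, Fintype.card_fin] at hlow hup
  -- positivity of `μ(P)` and nonnegativity of volumes
  have hP : 0 < volume.real (fundamentalDomain b) := measureReal_fundamentalDomain_pos b volume
  have hvolB : 0 ≤ volume.real B := measureReal_nonneg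
  -- rewrite the ratio `ρ/(R/2) = 2s`
  have e2s : ρ / (R / 2) = 2 * s := by rw [hs]; field_simp
  rw [e2s] at hlow
  change (1 - 2 * s) ^ n * volume.real S ≤ NS * volume.real (fundamentalDomain b) at hlow
  change NB * volume.real (fundamentalDomain b) ≤ (1 + ρ / R) ^ n * volume.real B at hup
  rw [← hs] at hup
  change (1 - a) * volume.real B ≤ volume.real S at h37
  -- Bernoulli-type bounds
  have h2s1 : 2 * (n * s) ≤ 1 := by linarith
  have hβ : 1 - 2 * (n * s) ≤ (1 - 2 * s) ^ n := by
    have h' := one_add_mul_le_pow (a := -(2 * s)) (by nlinarith) n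
    have e1 : (1 : ℝ) + -(2 * s) = 1 - 2 * s := by ring
    have e2 : (1 : ℝ) + n * -(2 * s) = 1 - 2 * (n * s) := by ring
    rwa [e1, e2] at h'
  have hβ0 : 0 ≤ 1 - 2 * (n * s) := by linarith
  have hγ : (1 + s) ^ n * (1 - n * s) ≤ 1 := one_add_pow_mul_one_sub_le hs0 n
  have hγ0 : 0 ≤ 1 - n * s := by linarith
  have h1s : 0 < (1 + s) ^ n := by positivity
  -- chain
  have c1 : (1 - 2 * s) ^ n * ((1 - a) * volume.real B) ≤ NS * volume.real (fundamentalDomain b) :=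
    (mul_le_mul_of_nonneg_left h37 (hβ0.trans hβ)).trans hlow
  -- `volume.real B ≥ NB μP (1 - n s)` from `hup` and `hγ`
  have c2 : NB * volume.real (fundamentalDomain b) * (1 - n * s) ≤ volume.real B := by
    calc NB * volume.real (fundamentalDomain b) * (1 - n * s)
        ≤ (1 + s) ^ n * volume.real B * (1 - n * s) := by gcongr
      _ = ((1 + s) ^ n * (1 - n * s)) * volume.real B := by ring
      _ ≤ 1 * volume.real B := by gcongr
      _ = volume.real B := one_mul _
  have c3 : (1 - 2 * (n * s)) * ((1 - a) * (NB * volume.real (fundamentalDomain b) * (1 - n * s))) ≤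
      NS * volume.real (fundamentalDomain b) := by
    calc (1 - 2 * (n * s)) * ((1 - a) * (NB * volume.real (fundamentalDomain b) * (1 - n * s)))
        ≤ (1 - 2 * s) ^ n * ((1 - a) * volume.real B) := by
          gcongr
          · linarith
      _ ≤ NS * volume.real (fundamentalDomain b) := c1
  have c4 : 1 - a - 3 * (n * s) ≤ (1 - a) * (1 - 2 * (n * s)) * (1 - n * s) := by
    have := one_sub_sub_sub_le_mul_mul (b := 2 * (n * s)) (c := n * s) ha0 (by positivity)
      (by positivity) ha1.le
    linarith
  have c5 : (1 - a - 3 * (n * s)) * (NB * volume.real (fundamentalDomain b)) ≤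
      NS * volume.real (fundamentalDomain b) := by
    calc (1 - a - 3 * (n * s)) * (NB * volume.real (fundamentalDomain b))
        ≤ ((1 - a) * (1 - 2 * (n * s)) * (1 - n * s)) * (NB * volume.real (fundamentalDomain b)) := by
          gcongr
      _ = (1 - 2 * (n * s)) * ((1 - a) * (NB * volume.real (fundamentalDomain b) * (1 - n * s))) := by
          ring
      _ ≤ NS * volume.real (fundamentalDomain b) := c3
  -- divide by `μ(P) > 0`
  have c6 : (1 - a - 3 * (n * s)) * NB * volume.real (fundamentalDomain b) ≤
      NS * volume.real (fundamentalDomain b) := by rw [mul_assoc]; exact c5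
  exact le_of_mul_le_mul_right c6 hP

end General

/-! ## Corollary 3.9 for the scaled grid `(1/L)ℤⁿ` and for `ℤⁿ` -/

section Grid

variable (n : ℕ)

/-- **Regev 2004, Corollary 3.9** (scaled grid `(1/L)ℤⁿ`, explicit constants): for `n ≥ 2`, `L > 0`,
`R > 0` and any `d ∈ ℝⁿ`,
`(1 − √n ‖d‖/R − 3 n^{1.5}/(R L)) · #((1/L)ℤⁿ ∩ B̄(0,R)) ≤ #((1/L)ℤⁿ ∩ B̄(0,R) ∩ B̄(d,R))`.
[cite: Regev2004, Cor. 3.9] -/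
theorem sub_mul_card_scaledGrid_le_card_inter (hn : 2 ≤ n) {L : ℝ} (hL : 0 < L) {R : ℝ}
    (hR : 0 < R) (d : EuclideanSpace ℝ (Fin n)) :
    (1 - Real.sqrt n * ‖d‖ / R - 3 * n * Real.sqrt n / (R * L)) *
        Nat.card (closedBall (0 : EuclideanSpace ℝ (Fin n)) R ∩ scaledGrid n L :
          Set (EuclideanSpace ℝ (Fin n))) ≤
      Nat.card ((closedBall (0 : EuclideanSpace ℝ (Fin n)) R ∩ closedBall d R) ∩ scaledGrid n L :
          Set (EuclideanSpace ℝ (Fin n))) := by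
  have hL0 : L ≠ 0 := hL.ne'
  have hρ : ∀ x : EuclideanSpace ℝ (Fin n),
      ‖x - (floor (gridBasis n hL0) x : EuclideanSpace ℝ (Fin n))‖ ≤ Real.sqrt n / L := fun x ↦ by
    simpa [abs_of_pos hL] using norm_sub_floor_gridBasis_le n hL0 x
  have h := sub_mul_card_le_card_inter (gridBasis n hL0) hn (ρ := Real.sqrt n / L)
    (by positivity) hρ hR d
  rw [coe_span_gridBasis] at h
  have e : 3 * (n : ℝ) * (Real.sqrt n / L) / R = 3 * n * Real.sqrt n / (R * L) := by
    field_simp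
  rw [e] at h
  exact h

/-- Membership in `scaledGrid n 1 = ℤⁿ`: all coordinates are integers. [folklore] -/
theorem mem_scaledGrid_one_iff {x : EuclideanSpace ℝ (Fin n)} :
    x ∈ scaledGrid n 1 ↔ ∀ i, ∃ k : ℤ, x i = k := by
  simp [mem_scaledGrid]

/-- **Regev 2004, Corollary 3.9 for the integer lattice `ℤⁿ`** (`L = 1`; the form used after scaling
the grid `(1/2ⁿ)ℤⁿ` of §3.3 to integers): for `n ≥ 2`, `T > 0`, `w ∈ ℝⁿ`,
`(1 − √n ‖w‖/T − 3 n^{1.5}/T) · #(ℤⁿ ∩ B̄(0,T)) ≤ #(ℤⁿ ∩ B̄(0,T) ∩ B̄(w,T))`.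
[cite: Regev2004, Cor. 3.9] -/
theorem sub_mul_card_intGrid_le_card_inter (hn : 2 ≤ n) {T : ℝ} (hT : 0 < T)
    (w : EuclideanSpace ℝ (Fin n)) :
    (1 - Real.sqrt n * ‖w‖ / T - 3 * n * Real.sqrt n / T) *
        Nat.card (closedBall (0 : EuclideanSpace ℝ (Fin n)) T ∩ scaledGrid n 1 :
          Set (EuclideanSpace ℝ (Fin n))) ≤
      Nat.card ((closedBall (0 : EuclideanSpace ℝ (Fin n)) T ∩ closedBall w T) ∩ scaledGrid n 1 :
          Set (EuclideanSpace ℝ (Fin n))) := by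
  simpa using sub_mul_card_scaledGrid_le_card_inter n hn one_pos hT w

/-! ## Integer vectors as points of `ℤⁿ ⊆ ℝⁿ` -/

/-- The integer vector `z : Fin n → ℤ` as a point of `ℝⁿ`. [folklore] -/
def intVec (z : Fin n → ℤ) : EuclideanSpace ℝ (Fin n) := toLp 2 fun i => (z i : ℝ)

/-- Coordinates of `intVec z`. [folklore] -/
@[simp] theorem intVec_apply (z : Fin n → ℤ) (i : Fin n) : intVec n z i = z i := rfl

/-- `intVec z ∈ ℤⁿ = scaledGrid n 1`. [folklore] -/
theorem intVec_mem_scaledGrid_one (z : Fin n → ℤ) : intVec n z ∈ scaledGrid n 1 :=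
  (mem_scaledGrid_one_iff n).2 fun i => ⟨z i, rfl⟩

/-- `intVec` is injective. [folklore] -/
theorem intVec_injective : Function.Injective (intVec n) := by
  intro z z' h
  funext i
  have := congrArg (fun x : EuclideanSpace ℝ (Fin n) => x i) h
  simpa using this

/-- Every point of `ℤⁿ = scaledGrid n 1` is `intVec z` for a unique integer vector. [folklore] -/
theorem exists_intVec_eq {x : EuclideanSpace ℝ (Fin n)} (hx : x ∈ scaledGrid n 1) :
    ∃ z : Fin n → ℤ, intVec n z = x := by
  rw [mem_scaledGrid_one_iff] at hx
  choose z hz using hx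
  refine ⟨z, ?_⟩
  ext i
  simp [hz i]

/-- `‖intVec z‖² = ∑ zᵢ²`. [folklore] -/
theorem norm_intVec_sq (z : Fin n → ℤ) : ‖intVec n z‖ ^ 2 = ∑ i, ((z i : ℤ) : ℝ) ^ 2 := by
  rw [EuclideanSpace.real_norm_sq_eq]; rfl

/-- `intVec z ∈ B̄(c, T) ↔ ∑ (zᵢ − cᵢ)² ≤ T²` for `T ≥ 0`. [folklore] -/
theorem intVec_mem_closedBall_iff (z : Fin n → ℤ) (c : EuclideanSpace ℝ (Fin n)) {T : ℝ}
    (hT : 0 ≤ T) : intVec n z ∈ closedBall c T ↔ ∑ i, ((z i : ℝ) - c i) ^ 2 ≤ T ^ 2 := by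
  rw [mem_closedBall, dist_eq_norm, ← pow_le_pow_iff_left₀ (norm_nonneg _) hT two_ne_zero,
    EuclideanSpace.real_norm_sq_eq]
  rfl

/-- The points of `ℤⁿ` in a set `A ⊆ ℝⁿ` are in bijection with the integer vectors `z` with
`intVec z ∈ A`; in particular the counts of Cor. 3.9 are counts of integer vectors.
[folklore] -/
def intVecEquiv (A : Set (EuclideanSpace ℝ (Fin n))) :
    {z : Fin n → ℤ // intVec n z ∈ A} ≃ (A ∩ scaledGrid n 1 : Set (EuclideanSpace ℝ (Fin n))) where
  toFun z := ⟨intVec n z.1, z.2, intVec_mem_scaledGrid_one n z.1⟩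
  invFun x := ⟨(exists_intVec_eq n x.2.2).choose, by
    rw [(exists_intVec_eq n x.2.2).choose_spec]; exact x.2.1⟩
  left_inv z := by
    apply Subtype.ext
    apply intVec_injective n
    exact (exists_intVec_eq n (intVec_mem_scaledGrid_one n z.1)).choose_spec
  right_inv x := by
    apply Subtype.ext
    exact (exists_intVec_eq n x.2.2).choose_spec

/-- The count of `ℤⁿ ∩ A` equals the count of integer vectors `z` with `intVec z ∈ A`.
[folklore] -/
theorem card_inter_scaledGrid_one (A : Set (EuclideanSpace ℝ (Fin n))) :
    Nat.card (A ∩ scaledGrid n 1 : Set (EuclideanSpace ℝ (Fin n))) =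
      Nat.card {z : Fin n → ℤ // intVec n z ∈ A} :=
  (Nat.card_congr (intVecEquiv n A)).symm

end Grid

end Literature.Algebra.EuclideanLattices
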